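import Summits.HodgeConjecture.HodgeConjecture.Theses.PadicSemiregularLift
import Summits.HodgeConjecture.HodgeConjecture.Theses.TropicalCuspLift
import Summits.HodgeConjecture.HodgeConjecture.Theorems.HodgeAbelianVarieties.Negative.ExtremeCodimensions
import Literature.AlgebraicGeometry.HodgeTheory.WeilClasses
import Literature.AlgebraicGeometry.HodgeTheory.MotivatedClasses
import Literature.AlgebraicGeometry.Motives.HyperbolicWeilType
import Literature.AlgebraicGeometry.Motives.AbelianVarietyProjectiveChart

/-!
# Skeleton line `e-step-secant-induction` for crux `HodgeAbelianVarieties` (stmt-HodgeConjecture-1333)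

Route `PadicSemiregularLift`, crux r4 (typed OUTPUT item)
`HodgeAbelianVarieties := ∀ A : AbelianVariety ℂ, HodgeConjectureFor A.dim A.X` — the Hodge conjecture
for every complex abelian variety (= the summit restricted to abelian varieties:
`Negative.iff_hodgeConjecture_restricted`, landed p70486).

## The line (crux idea `e-step-secant-induction`, crux-ideate r1 ideator 2; triage r1: 3 × pass)

THE E-STEP. Markman (arXiv:2502.03415 §1.2–§1.5, Thm 1.5.1; survey arXiv:2509.23403 §4, §11) proves
the Weil classes on every polarized abelian SIXFOLD of SPLIT Weil type (`K = ℚ(√-d)`, all `d`) from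
two `G`-equivariant SECANT SHEAVES `F₁, F₂` on a principally polarized abelian THREEFOLD `X = J(C₃)`
satisfying his Hochschild criterion "`ker ev_F = ann ch(F)`, `ev_F` onto the invariants" (Lemma 11.3,
Prop. 11.5), transported to the anchor `X × X̂` by Orlov's equivalence and deformed by the
Buchweitz–Flenner/Pridham semiregularity theorem over the whole `9`-dimensional Weil moduli; he stops
at `dim X ≤ 3` ("we are currently able to handle [semiregularity] only for `dim(X) ≤ 3`", §11; genus-4
candidates "yet to be checked", §12). The idea replaces "new curve geometry per genus" by ONE
inductive sheaf construction `X ↦ X × E` (`E` any elliptic curve, `Θ' = Θ ⊞ Θ_E`; §1.2 of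
arXiv:2502.03415 needs only an AMPLE class, so the decomposable anchor is legitimate): since
`e^{√-qΘ'} = e^{√-qΘ}(1 + √-q[o])` the secant plane of `X × E` is
`B' = ⟨α⊠1 − qβ⊠[o], β⊠1 + α⊠[o]⟩`, and a secant sheaf `F` on `X` (`ch F = aα + bβ`) becomes a secant
sheaf on `X × E` by one elementary (Hecke) modification along fibres `X × {p_j}`:
`F' := ker(F ⊠ 𝒪_E(m·p) → ⊕ⱼ Q ⊠ 𝒪_{p_j})` with `Q` a secant (sheaf or derived) quotient of `F`,
`k·ch Q = (ma − b)α + (mb + qa)β` ⟹ `ch F' = aα' + bβ'` (verified by all three triagers). The criterion is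
Künneth-stable (Markman's own step, survey p.19) and FM-invariant, so the WHOLE inductive weight sits on
one local question: does the criterion (kernel identity AND surjectivity onto `G × G_E`-invariants, incl.
the `Ext¹`-generation part of Prop. 11.5) survive one Hecke modification by a secant quotient along a
`G_E`-orbit of fibres? Output of the machine at level `n+1`: Weil classes on every SPLIT polarized
Weil-type `2(n+1)`-fold (one split component per `(K, n+1)` up to isogeny, van Geemen / Deligne–Milne;
isogeny descent is PROVED in the tree, `WeilClassesIsogenyDescent`); DESCENDING (Schoen 1998 §10 =
Markman §11.5 Step 2: product with a Weil surface of complementary discriminant) then gives ALL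
Weil-type `2n`-folds; the complement "Weil classes (imaginary quadratic, all `n`, `d`) ⟹ HC(AV)" is
André 1992 for CM abelian varieties dominated by imaginary-quadratic Weil types plus an OPEN transport
(Weil classes for higher-degree CM fields, Markman survey Thm 1.4; CM-to-general), carried as the parked
stub `stub_weilSectorSuffices` exactly as `TropicalCuspLift.Assembly` carries it at summit level.

TYPING DECISION (triage r1-1/r1-2/r1-3 common hazard, honoured): the object-level criterion has NO genuine
carrier in the tree (`SemiregularityData`/`TwistedSemiregularityData`/`ChernCharacterBetti` are all-data
hypothesis structures; any `∃`-over-structure seed predicate is junk-inhabitable, shown in TRIAGE-r1-2/3 for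
`HasBlochWeilSeed`), so every stub is stated at CLASS level on REAL carriers (`weilClassesOf`,
`algebraicClasses`, `IsRationalClass`, `IsOfHodgeType`, `IsHyperbolicWeilType`, `IsPolarizationClass`);
the E-step induction on OBJECTS lives inside `stub_eTower` (and its calibration inside
`stub_splitSixfolds`) and is spelled out in the line card `Lines/e-step-secant-induction.md`. The ideator's
`WeilAlgebraicHyperbolic` (IdeatorTwoSketch.lean) was MIS-TYPED — it allowed `h = 0`, for which every
`φ`-stable rational half-frame is isotropic, so it silently equalled `WeilAlgebraicAll`; here a SPLIT
TRIPLE carries a polarization class (`IsPolarizationClass`: rational, divisorial, hard Lefschetz — the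
tree's rendering; positivity has no carrier) that is `φ`-compatible (`φ^* h = d·h`).

`HodgeAbelianVarieties_of` composes the four stubs into the crux BY NAME (kernel-checked, no `sorry`);
`weilSixfolds_of` records the line's FIRST NEW OUTPUT in the tree's own terms: split eightfolds
(`stub_eTower` at `n = 4`) + descending ⟹ `TropicalCuspLift.WeilSixfolds` (stmt-HodgeConjecture-2524, the
printed frontier: sixfolds of discriminant `≠ -1`, arXiv:2603.20268 p.3).

## Disproof used (cdisprove `Disproof.lean`, 2026-08-15T23:37Z, NO KILL; landed
`Theorems/HodgeAbelianVarieties/Negative/ExtremeCodimensions.lean`, p70486 — IMPORTED here)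
* `iff_hodgeConjecture_restricted` / `not_hodgeConjecture_of_not`: the crux is HC restricted to AV; a
  line through the Weil sector MUST carry the complement — `stub_weilSectorSuffices` is that edge, named.
* `hodgeAbelianVarieties_iff_deepMiddle`: a counterexample needs `2 ≤ p`, `2p ≤ dim A` — consistent: the
  line works at `p = n` on `2n`-folds, `n ≥ 3` (`stub_splitSixfolds`, `stub_eTower`), and descends.
* Disproof §3 `weilItems_of` / `not_of_not_weilSixfolds` (work file): the crux IMPLIES
  `TropicalCuspLift.WeilClassesAlgebraic ∧ WeilSixfolds`; here the converse bookkeeping is proved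
  (`weilClassesAlgebraic_of`, `weilSixfolds_of`): the Weil part of the skeleton is NECESSARY, not padding.
* `not_integralSaturationOnAbelianVarieties` (EdGFS 2025): honoured — every stub concludes membership in
  the `ℂ`-span `algebraicClasses` of RATIONAL classes; no integral statement (`κ = ch·e^{-c₁/r}` has
  denominators; `μ_r`-gerbes as in survey §2).
* `kaehler_analogue_fails` (Voisin 2002) / `_false_without_proper` / `_false_without_groupLaw`: honoured —
  binders are `AbelianVariety ℂ` (proper, group law, projective PROVED), families are the algebraic polarized
  Weil families; "the line uses projectivity at `stub_eTower`/`stub_splitSixfolds`" (BF over an algebraic base).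
* `not_allHodgeTypeClassesAlgebraicOnAbelianVarieties`: honoured — `IsRationalClass c` is a hypothesis of
  `WeilAlgebraicFor`.
* `ledger negatives --problem HodgeConjecture` (ELineConnectivity, DerivedTorelliFermat K3): no stub is an
  instance. Route-internal refutations (rattack-1498-0 Godeaux–Serre, rattack-1805-0 twist-rigidity):
  not met (no p-adic statement in this line).
-/

set_option linter.dupNamespace false

noncomputable section

open CategoryTheory
open Literature.AlgebraicGeometry Literature.AlgebraicGeometry.Motives
  Literature.AlgebraicGeometry.HodgeTheory

namespace Summit.HodgeConjecture.HodgeConjecture.Cruxes.HodgeAbelianVarieties.EStepSecantInduction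

/-! ### Vocabulary (real carriers only) -/

/-- **Weil classes of `(A, φ)` in half-dimension `n` for `K = ℚ(√-d)` are algebraic**: every RATIONAL
class of Hodge type `(n,n)` in the complexified Weil plane `weilClassesOf A φ n d = E₊ ⊔ E₋ ⊆ H²ⁿ(A(ℂ);ℂ)`
lies in `algebraicClasses A.X n = Nⁿ H²ⁿ`. Same binder shape as `TropicalCuspLift.WeilClassesAlgebraic`
(`mem_weilClassesOf_iff` is the dictionary). -/
def WeilAlgebraicFor (n d : ℕ) (A : AbelianVariety ℂ) (φ : A ⟶ A) : Prop :=
  ∀ c ∈ weilClassesOf A φ n d, IsRationalClass c → IsOfHodgeType (2 * n) A.X (2 * n) n n c →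
    c ∈ algebraicClasses A.X n

/-- **All Weil-type pairs** of dimension `2n` for `K = ℚ(√-d)`: `φ ≫ φ = -d`. (If the `K`-signature is not
`(n,n)` the only rational `(n,n)`-class of the Weil plane is `0`, so nothing is lost by not saying
"of Weil type".) -/
def WeilAlgebraicAll (n d : ℕ) : Prop :=
  ∀ (A : AbelianVariety ℂ) (φ : A ⟶ A), A.dim = 2 * n → φ ≫ φ = -(d • 𝟙 A) → WeilAlgebraicFor n d A φ

/-- **A polarized Weil triple `(A, φ, h)` of dimension `2n` for `K = ℚ(√-d)` of SPLIT (= hyperbolic)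
type**: `φ ≫ φ = -d`; `h ∈ H²(A(ℂ);ℂ)` a polarization class in the tree's sense (`IsPolarizationClass`:
rational, supported on a divisor, hard Lefschetz in dimension `2n` — in particular `h ≠ 0`, which the
ideator's typing forgot) that is `φ`-COMPATIBLE (`φ^* h = d·h`, van Geemen 5.2: `E(√-d x, √-d y) = d E(x,y)`;
Markman "`η(k)` maps `h` to `Nm(k) h`"); and a `φ^*`-stable rational LAGRANGIAN `2n`-frame of `H¹` for
`h^{2n-1} ⌣ x ⌣ y` (`IsHyperbolicWeilType`; = Witt index `n` = `det H = (-1)ⁿ mod Nm K^×`, Landherr /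
van Geemen 5.4 / Deligne–Milne, survey §11.5 Step 1). These are the triples Markman's machine reaches
(`X × X̂` has `det H = (-1)ⁿ`, arXiv:2502.03415 Lemma 3.1.3). Caveat recorded, not hidden: positivity of
`h` has no carrier, so the predicate is a priori wider than "ample"; immaterial for the composition. -/
def IsSplitWeilTriple (n d : ℕ) (A : AbelianVariety ℂ) (φ : A ⟶ A) (h : complexBetti A.X 2) : Prop :=
  A.dim = 2 * n ∧ φ ≫ φ = -(d • 𝟙 A) ∧ IsPolarizationClass (2 * n) A.X h ∧
    complexBetti.map φ.hom.hom.hom 2 h = (d : ℂ) • h ∧ IsHyperbolicWeilType A φ n h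

/-- **Weil classes are algebraic on every SPLIT polarized Weil triple of dimension `2n`** for
`K = ℚ(√-d)` — the sector Markman's secant-sheaf machine outputs (one split component per `(K, n)` up
to isogeny; isogeny descent PROVED in the tree, `WeilClassesIsogenyDescent`). -/
def WeilAlgebraicSplit (n d : ℕ) : Prop :=
  ∀ (A : AbelianVariety ℂ) (φ : A ⟶ A) (h : complexBetti A.X 2),
    IsSplitWeilTriple n d A φ h → WeilAlgebraicFor n d A φ

/-- Sanity (proved): the split sector is a sub-case of the full sector. -/
theorem weilAlgebraicSplit_of_all {n d : ℕ} (h : WeilAlgebraicAll n d) : WeilAlgebraicSplit n d :=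
  fun A φ _ ht => h A φ ht.1 ht.2.1

/-! ### The four registered stubs -/

/-- STUB 1 (L–XL; TRUE IN PRINT, the line's CALIBRATION) — **split Weil SIXFOLDS, every `K = ℚ(√-d)`**:
Markman, arXiv:2502.03415 Thm 1.5.1 ("The Hodge-Weil classes of polarized abelian sixfolds of Weil type
with complex multiplication by `K` and with discriminant `-1` are algebraic"), via `J(C₃)`, `d ≥ 3`
(`d ↦ 4d` otherwise), Assumption 9.1.1, Prop. 11.1, Lemma 11.2–11.3, Prop. 11.5. ROLE IN THIS LINE: the
E-step must first REPRODUCE it from an abelian SURFACE — anchor `X₃ = S × E`, seeds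
`F' = ker(F ⊠ 𝒪_E(mp) → Q ⊠ 𝒪_p)` with the card's class-level solutions (`q = 1`: `F = I_W(Θ)`, `|W| = 2`,
`Q = 𝒪_D(Θ)`, `D ∈ |2Θ|`; general `q`: rank-2 `F = ker(V → 𝒪_W)`) — i.e. the card's CHEAPEST FALSIFIER
(criterion (α) kernel + surjectivity on `G × G_E`-invariants, `dim HT²(S×E) = 15`; (β) Markman's
linear-independence condition `γ ≠ 0`) is the first computation under this stub; a failure there kills the
E-step as a criterion-carrier while this statement stays true in print. Why this base and not Markman's
`J(C₃)` seeds: those need `d ≥ 3` (`d+1` curves, Assumption 9.1.1), and for such `d` the card shows the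
`m = 1` sheaf-quotient E-step is CLASS-OBSTRUCTED, so the `S × E^{n-2}` tower is the honest one.
Leans on (paper): BF/Pridham twisted semiregularity (survey Thm 2.1/§2, proved for abelian families in
arXiv:2502.03415 §7), Orlov/Mukai/Polishchuk spin action (§3), pure spinors (§5), Lemma 11.3, Toda/Huang. -/
theorem stub_splitSixfolds : ∀ d : ℕ, 0 < d → WeilAlgebraicSplit 3 d := by
  sorry

/-- STUB 2 (XL, OPEN — the line's TARGET and hardest ATTACKABLE stub) — **the E-TOWER: split Weil
`2n`-folds for every `n ≥ 4` and every `K = ℚ(√-d)`** (first open instance `n = 4`: split EIGHTFOLDS,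
hence all sixfolds by `stub_descend` — `weilSixfolds_of` below; in print "completely open",
arXiv:2603.20268 p.3, van Geemen LNM 1594 Thm 4.11, survey §12). INTENDED PROOF = the E-step induction on
OBJECTS (invisible at class level; this statement is its output): anchors `X_n = S × E^{n-2}` (or
`J(C₃) × E^{n-3}` for `d ≥ 3` with derived/rank-2 quotients), seeds `F'₁, F'₂` on `X_{n+1} = X_n × E` obtained
from the level-`n` seeds by ONE Hecke modification along a `G_E`-orbit of fibres with a secant quotient
`Q` (`k·ch Q = (ma−b)α + (mb+qa)β`), the three conditions of Markman's strategy (survey §4: (i) criterion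
`ker ev = ann ch` + surjectivity onto `(G × G_E)`-invariants ⟹ semiregular after descent, Lemma 11.3 /
Prop. 11.5 pattern; (ii) `κ` remains Hodge — AUTOMATIC for secant^{⊠2} objects, arXiv:2502.03415
Cor. 1.3.2, any ample `Θ'`; (iii) `κ_{n+1} ∉ Sym(𝒜²)`, the BB/linear-independence check) verified
INCREMENTALLY from the long exact sequences of the one defining triangle, then BF/Pridham over the split
component, Baire/Hilbert scheme, isogeny descent (tree). Why it might fail: the criterion is NOT obviously
stable under elementary modification (`Ext²(F',F')` acquires `Ext¹(F⊠L, Q⊠𝒪_p)`- and `Ext²(Q,Q)⊗H⁰`-terms;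
the bet is that `G_E`-invariants cut them as `G₁ × G₂` cut Markman's `q+1` curves), the surjectivity half
needs `HH¹ → Ext¹(F',F')^{inv}` iso + generation (Prop. 11.5 proof) for the NEW sheaf, and for some `(n, q)`
the class equation for `Q` may have no sheaf solution (card: `J(C₃)`, `q ≥ 2`, `m = 1`). Honours
`hodgeAbelianVarieties_iff_deepMiddle` (`p = n ≥ 4`, `2p = dim`). -/
theorem stub_eTower : ∀ n d : ℕ, 4 ≤ n → 0 < d → WeilAlgebraicSplit n d := by
  sorry

/-- STUB 3 (L; TRUE IN PRINT — DESCENDING, Schoen 1998 §10 Prop. = Koike 2004 = Markman survey §11.5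
Step 2, all `n`) — **split `2(n+1)`-folds give ALL Weil-type `2n`-folds**: given `(A, φ)` of dimension
`2n`, `φ² = -d` (signature `(n,n)`, else vacuous) choose a `φ`-compatible polarization `h`
(`E₀ + d⁻¹ φ^*E₀`), a Weil SURFACE `(S, ψ, h_S)` for the same `K` whose discriminant makes
`det(H_A ⊕ H_S) = (-1)^{n+1} mod Nm K^×` ("every value … is realized … in every even dimension",
van Geemen; discriminant multiplicative), so `(A × S, φ × ψ, p₁^*h + p₂^*h_S)` is a SPLIT triple
(Landherr / Deligne–Milne: split iff `det = (-1)^{n+1}`; frame dictionary of `HyperbolicWeilType` (1)–(4));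
the hypothesis makes `W_{A×S}` algebraic, and Schoen's Gysin argument
`w = pr_{A*}((P₊₊ + P₋₋) ⌣ p₂^* w')` returns to `A` (upward half PROVED in the tree:
`WeilClassesProducts.weilEigencomponents_cupProduct_mem_algebraicClasses`; downward half needs the Gysin
push-forward with projection formula — `ComplexGysin`, conditional on `bijective_poincareDualityMap`).
Formal debt (why L and not M): Weil surfaces `E_τ × E_τ` as `AbelianVariety ℂ` with computed `H¹`,
the Riemann-form/`det H` dictionary for `IsHyperbolicWeilType`, hard Lefschetz for `p₁^*h + p₂^*h_S`
(named fact `nonempty_hardLefschetzNFold`), top-degree/Gysin bookkeeping on `A × S`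
(`Motives.AbelianVariety.prod`). Sources: Schoen1998HodgeWeilAddendum §10; Markman2025SurveySecant §11.5;
vanGeemen1994HodgeAV 5.2–5.4; arXiv:2502.03415 §1.6. -/
theorem stub_descend :
    ∀ n d : ℕ, 2 ≤ n → 0 < d → WeilAlgebraicSplit (n + 1) d → WeilAlgebraicAll n d := by
  sorry

/-- STUB 4 (XXL, OPEN — the COMPLEMENT, carried for honesty, NOT attacked by this line; promotion /
sharing candidate) — **the imaginary-quadratic Weil sector suffices for HC on abelian varieties**:
`TropicalCuspLift.WeilClassesAlgebraic` (stmt-HodgeConjecture-2522: Weil classes on every Weil-type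
`(A, φ)`, all `2n ≥ 4`, all `K = ℚ(√-d)`) ⟹ the crux. Status: implied by the crux (so irrefutable unless
HC fails); KNOWN parts in print — `dim A ≤ 5` (Moonen–Zarhin + Ramón Marí + Markman Cor. 1.3), Hodge rings
generated by divisors (Mattuck general, Tankeev prime dimension, Tate/Imai/Murasaki `Eⁿ`), CM abelian
varieties whose André decomposition (survey Thm 1.4: `t = Σ fᵢ^* tᵢ`, `tᵢ` Weil classes on split Weil-type
`Aᵢ` for CM FIELDS `Kᵢ`) involves only imaginary-quadratic `Kᵢ`; OPEN parts — Weil classes relative to CM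
fields of degree `> 2` (Markman's `[markman-CM]`, survey §12) and the CM-to-general transport (no
principle B for algebraic classes; the route's own p-adic thesis P1–P3 and `ConservativityLefschetz` aim
there). It is the AV-restriction of `TropicalCuspLift.Assembly` (summit-level complement, gate-accepted
as "NOT claimed"); filed so that `HodgeAbelianVarieties_of` concludes the crux BY NAME, as every
Weil-sector line for this crux must. Provers: land partials (`dim ≤ 5` from named facts) or leave it. -/
theorem stub_weilSectorSuffices :
    Summit.HodgeConjecture.HodgeConjecture.Theses.TropicalCuspLift.WeilClassesAlgebraic →
      Summit.HodgeConjecture.HodgeConjecture.Theses.PadicSemiregularLift.HodgeAbelianVarieties := by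
  sorry

/-! ### Named statements = the registered stubs (definitionally) -/

/-- The statement of `stub_splitSixfolds`. -/
def SplitSixfolds : Prop := ∀ d : ℕ, 0 < d → WeilAlgebraicSplit 3 d
/-- The statement of `stub_eTower`. -/
def ETower : Prop := ∀ n d : ℕ, 4 ≤ n → 0 < d → WeilAlgebraicSplit n d
/-- The statement of `stub_descend`. -/
def Descend : Prop := ∀ n d : ℕ, 2 ≤ n → 0 < d → WeilAlgebraicSplit (n + 1) d → WeilAlgebraicAll n d
/-- The statement of `stub_weilSectorSuffices`. -/
def WeilSectorSuffices : Prop :=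
  Summit.HodgeConjecture.HodgeConjecture.Theses.TropicalCuspLift.WeilClassesAlgebraic →
    Summit.HodgeConjecture.HodgeConjecture.Theses.PadicSemiregularLift.HodgeAbelianVarieties

theorem splitSixfolds_holds : SplitSixfolds := stub_splitSixfolds
theorem eTower_holds : ETower := stub_eTower
theorem descend_holds : Descend := stub_descend
theorem weilSectorSuffices_holds : WeilSectorSuffices := stub_weilSectorSuffices

/-! ### Name-keyed aliases of the four statements (the hypotheses of the composition) -/
namespace Registered

/-- Alias of `SplitSixfolds` keyed by the registered stub name. -/
abbrev stub_splitSixfolds : Prop := SplitSixfolds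
/-- Alias of `ETower` keyed by the registered stub name. -/
abbrev stub_eTower : Prop := ETower
/-- Alias of `Descend` keyed by the registered stub name. -/
abbrev stub_descend : Prop := Descend
/-- Alias of `WeilSectorSuffices` keyed by the registered stub name. -/
abbrev stub_weilSectorSuffices : Prop := WeilSectorSuffices

end Registered

/-! ### Glue (proved, no `sorry`) -/

/-- Split Weil classes in EVERY half-dimension `m ≥ 3` from the calibration (`m = 3`) and the tower
(`m ≥ 4`). -/
theorem weilAlgebraicSplit_of_ge_three (h₁ : SplitSixfolds) (h₂ : ETower) {m d : ℕ} (hm : 3 ≤ m)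
    (hd : 0 < d) : WeilAlgebraicSplit m d := by
  rcases Nat.lt_or_ge m 4 with h | h
  · obtain rfl : m = 3 := by omega
    exact h₁ d hd
  · exact h₂ m d h hd

/-- All Weil-type `2n`-folds, `n ≥ 2`, from split `2(n+1)`-folds and descending. -/
theorem weilAlgebraicAll_of (h₁ : SplitSixfolds) (h₂ : ETower) (h₃ : Descend) {n d : ℕ} (hn : 2 ≤ n)
    (hd : 0 < d) : WeilAlgebraicAll n d :=
  h₃ n d hn hd (weilAlgebraicSplit_of_ge_three h₁ h₂ (by omega) hd)

/-- **The Weil part of the skeleton closes the tree's typed Weil target**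
`TropicalCuspLift.WeilClassesAlgebraic` (stmt-HodgeConjecture-2522) — the dictionary is
`mem_weilClassesOf_iff` (the item's inline eigen-decomposition IS membership in `weilClassesOf`). -/
theorem weilClassesAlgebraic_of (h₁ : SplitSixfolds) (h₂ : ETower) (h₃ : Descend) :
    Summit.HodgeConjecture.HodgeConjecture.Theses.TropicalCuspLift.WeilClassesAlgebraic := by
  intro n hn d hd A φ hA _hX hφ c hc hH hw
  exact weilAlgebraicAll_of h₁ h₂ h₃ hn hd A φ hA hφ c (mem_weilClassesOf_iff.2 hw) hc hH

/-- **The line's first NEW output, in the tree's terms**: split EIGHTFOLDS (`ETower` at `n = 4`) plus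
descending give `TropicalCuspLift.WeilSixfolds` (stmt-HodgeConjecture-2524: Weil classes on abelian
sixfolds of EVERY discriminant — "outside [disc `-1`] … completely open", arXiv:2603.20268 p.3). This is the
card's "ℚ(i) eightfolds ⟹ all ℚ(i) sixfolds", for every `K`. -/
theorem weilSixfolds_of (h₂ : ETower) (h₃ : Descend) :
    Summit.HodgeConjecture.HodgeConjecture.Theses.TropicalCuspLift.WeilSixfolds := by
  intro d hd A φ hA _hX hφ c hc hH hw
  exact h₃ 3 d (by norm_num) hd (h₂ 4 d le_rfl hd) A φ hA hφ c (mem_weilClassesOf_iff.2 hw) hc hH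

/-! ### The composition: the four stubs imply the crux, by name -/

/-- `HodgeAbelianVarieties` from the four stubs (pure logic; no `sorry`): STUB 1 (split sixfolds) and
STUB 2 (the E-tower, `n ≥ 4`) give split Weil classes in every half-dimension `≥ 3`; STUB 3 descends
them to all Weil-type `2n`-folds, `n ≥ 2`, i.e. `TropicalCuspLift.WeilClassesAlgebraic`
(`weilClassesAlgebraic_of`); STUB 4 is the complement edge to the crux. -/
theorem HodgeAbelianVarieties_of (h₁ : Registered.stub_splitSixfolds) (h₂ : Registered.stub_eTower)
    (h₃ : Registered.stub_descend) (h₄ : Registered.stub_weilSectorSuffices) :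
    Summit.HodgeConjecture.HodgeConjecture.Theses.PadicSemiregularLift.HodgeAbelianVarieties :=
  h₄ (weilClassesAlgebraic_of h₁ h₂ h₃)

/-- Wiring check: the registered stubs feed `HodgeAbelianVarieties_of` as stated. -/
example : Summit.HodgeConjecture.HodgeConjecture.Theses.PadicSemiregularLift.HodgeAbelianVarieties :=
  HodgeAbelianVarieties_of stub_splitSixfolds stub_eTower stub_descend stub_weilSectorSuffices

/-- Consistency with the landed Negative lemma (p70486): what the skeleton proves is literally the
summit restricted to abelian varieties — no stub is an instance the Negative file refutes (it refutes
nothing; it locates counterexamples at `2 ≤ p ≤ dim/2`, where STUBS 1–2 work). -/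
example (h₁ : SplitSixfolds) (h₂ : ETower) (h₃ : Descend) (h₄ : WeilSectorSuffices) :
    ∀ A : AbelianVariety ℂ, IsSmoothProjective A.dim A.X → HodgeConjectureFor A.dim A.X :=
  Summit.HodgeConjecture.HodgeConjecture.Theorems.HodgeAbelianVarieties.Negative.iff_hodgeConjecture_restricted.1
    (HodgeAbelianVarieties_of h₁ h₂ h₃ h₄)

end Summit.HodgeConjecture.HodgeConjecture.Cruxes.HodgeAbelianVarieties.EStepSecantInduction

end
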